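import Summits.QuantumFields.YangMills.Theorems.UnitScaleTiltProp7SPrintCond135
import Summits.QuantumFields.YangMills.Theorems.UnitScaleTiltProp7BasedTranslate
import Literature.MathematicalPhysics.QuantumFieldTheory.Balaban1983to89.B8Eq131Derivation
import HarnessLib

/-!
# Route `UnitScaleTilt`, crux K1 child «MinimiserStabilityRegPr» (stmt-QuantumFields-19200), registered stub `stub_prop7From14` (skeleton birth_v7
# cc37a178…; leaf V3), pillar P-V3-A′ — **THE (c2) DICTIONARY OF OWNER RULING g23-№3: ROW (T2) ⇐ `B8Thm2SetupTorus.Thm2SetupSUAt` AT `x₀`-TRANSLATED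
# DATA**, hence **`prop2Printed_sPrint_of_thm2SetupSUAt`: the v8 pillar text `B11.Prop2Printed … (famLG3 L (sPrint L T))` FROM THE TREE'S INTERFACE
# FOR [Balaban1985RegularSpaces] THEOREM 2 (`Ω_j = T_η`, `SU(2)`, regularity rider (3.35) dropped) BY NAME**

Cell `ym3-torus` ∕ width seat `ym-ust-19200-w1` (gen 0; D-0149; HUMAN RULING D-0037 — YM₃ on T³ is ladder rung R3, not the Clay problem).  WHY.
RULING g23-№3 (c2): «the [B8] Thm 2 input for based letters = `Thm2SetupSUAt` on x₀-translates, supplied BY NAME through that dictionary (p1's «dictionary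
owed by whoever pens P-V3-A» — accepted as a pen obligation)».  `Prop7SPrintCond135.prop2Printed_sPrint_of_thm2` (p585942) takes [6] Thm 2 as ONE row (T2)
read at the `k`-centre `x₀`; `Prop7BasedTranslate` (p575006) says the based letters are the B8 lane's origin letters of the translate `τ_{x₀}`.  This file
composes the two: `Thm2SetupSUAt (F.P K) 2 (K−n) η β₀ B₁ B₂ c₁ len (fun _ => True)` at the translated pair `(τU₀, τU′)` yields a translated gauge `uᵗ` and
one-form `Aᵗ`; translating back (`u x = uᵗ(x − (x₀ − 0))`, `A = τ⁻¹Aᵗ`) gives row (T2)'s `(u, U₁ := (UU₀⁻¹)^{u⁻¹} relative to U₀, A)` with `(U₁U₀)^u = U`,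
`U₁ = e^{iηA}` bondwise ([Balaban1985RegularSpaces] (1.17) = `B7Eq92Concrete.mgauge`, `B8Eq131Derivation.eq117_eq_mgauge`), and (1.36) ∕ (1.38) ∕ (1.39) on the
based pullbacks.

WHAT IS PROVED (sorry-free, no definition).  §1 translate-back bookkeeping (`translate_untranslate`, `gauge_untranslate`, `pullGauge_inv`,
`mulCfg_pull`, `pert_pull`, `coe_pull_unitsField`); §2 **`thm2Based_of_thm2SetupSUAt`** — row (T2) at one member from
`Thm2SetupSUAt … (fun _ => True)`; §3 **`prop2Printed_sPrint_of_thm2SetupSUAt`** — `∃ B₁′ c₁′ > 0, Prop2Printed B₁′ B₃ L³ c₁′ (famLG3 L (sPrint L T))` for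
every Sect. C–E tail `T` and `B₃ ≥ 0` from `∀ members, ∃ β₀ B₂ len, Thm2SetupSUAt (F.P K) 2 (K−n) (eta F n K) β₀ B₁ B₂ c₁ len (fun _ => True)`.

HONEST SCOPE.  A dictionary; [6] Theorem 2 is NOT proved — `Thm2SetupSUAt` is an interface (hypothesis shape) and is taken here as a hypothesis with the
regularity rider `Reg := fun _ => True` (print p. 82 «eventually we will drop it out of the assumptions», [6] Prop. 6).  So P-V3-A′ at `S_print` is
CONDITIONAL on exactly the tree's [6]-Thm-2 interface and nothing else.  Count-neutral helper toward stmt-QuantumFields-19200 (`--supports`), not a proof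
of the stub; nothing continuum ∕ OS ∕ mass-gap ∕ Clay.

References: T. Bałaban, CMP **99** (1985) 75–102 [Balaban1985RegularSpaces] ((1.17) p.78, (1.29) p.81, (1.33)–(1.38) p.82, (1.39) and Thm 2 p.83);
CMP **102** (1985) 277–309 [Balaban1985Variational] ((14)–(18) p.280, Prop. 2 p.281); CMP **98** (1985) 17–51 [Balaban1985Averaging] ((8) p.19, (55) p.27).
-/

noncomputable section

namespace Summit.QuantumFields.YangMills.Theorems.Prop7SPrintThm2Dict

open scoped Matrix.Norms.L2Operator
open NormedSpace
open Literature.MathematicalPhysics.QuantumFieldTheory.Balaban1983to89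
open Literature.MathematicalPhysics.QuantumFieldTheory.Balaban1983to89.T3ContinuumYM3Torus
open Literature.MathematicalPhysics.QuantumFieldTheory.Balaban1983to89.T3PrintedRegularMinimiser (RegPr regPr_iff_inSpace)
open Literature.MathematicalPhysics.QuantumFieldTheory.Balaban1983to89.T3UnitLawGaugeInvariance (gaugeAct_gaugeAct)
open B7Prop1Explicit renaming Site → LSite
open B7Prop1Explicit (e val_expUnit)
open B7Eq92Concrete (mgauge)
open B8Lemma1NonAbelian (mulCfg)
open B8Eq131Derivation (eq117_eq_mgauge)
open B8Eq138LandauZd (IsLandau138)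
open B8Eq184Proof (cfgExp)
open B8Thm4TorusAt (torusLam)
open B8Thm2TorusAt (C136T C139T Cond135T hyp135_torusLam_iff)
open B8Thm2SetupTorus (Thm2SetupSUAt Concl2Setup toUGauge pullGauge pullGauge_apply cfgPull gaugePull InAxT Restr129T Hyp135T)
open B10Eq27TorusAxialLog (transl transl_add transl_zero transl_rel rel pull pull_apply unitsField toUField val_unitsField val_suIncl)
open B11 (Prop2Printed)
open T3Thm1Carrier
open T3SectALandauChart (ResidFam famLG3 pert emb15 eta eta_pos bgUnits pos_of_regPr)
open Summit.QuantumFields.YangMills.Theorems.Prop7SPrint (basePt IsAxialPrint RestrictedPrint sPrint)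
open Summit.QuantumFields.YangMills.Theorems.Prop7AxialReprPrint (pull_toUField_gaugeAct)
open Summit.QuantumFields.YangMills.Theorems.Prop7BasedTranslate (pull_translate cfgPull_translate gaugePull_translate inAxT_translate_iff
  restr129T_translate_iff hyp135T_translate_iff inSpace_univ_translate_iff)
open Summit.QuantumFields.YangMills.Theorems.Prop7SPrintCond135 (prop2Printed_sPrint_of_thm2)

/-! ## §1 Translate-back bookkeeping -/

section Translate

variable {P : Params} {G : Type*}

/-- Translating by `−a` then by `a` returns the original one-form: `τ_a(τ_{−a}A) = A`. [cite: Balaban1987RG1, (0.1) p.251] -/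
theorem translate_untranslate (A : GaugeField P 0 G) (a : LSite P.d) :
    (fun b : PBond P 0 => (fun b' : PBond P 0 => A ⟨transl b'.src (-a), b'.dir⟩) ⟨transl b.src a, b.dir⟩) = A := by
  funext b
  show A ⟨transl (transl b.src a) (-a), b.dir⟩ = A b
  rw [← transl_add, add_neg_cancel, transl_zero]

/-- The same for gauge transformations: `(τ_a(τ_{−a}u))(x) = u(x)`. [cite: Balaban1987RG1, (0.1) p.251] -/
theorem gauge_untranslate (u : GaugeTransf P 0 G) (a : LSite P.d) :
    (fun x : Site P 0 => (fun x' : Site P 0 => u (transl x' (-a))) (transl x a)) = u := by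
  funext x
  show u (transl (transl x a) (-a)) = u x
  rw [← transl_add, add_neg_cancel, transl_zero]

end Translate

section Pull

variable {P : Params} {N : ℕ}

/-- The inverse of a pulled-back `SU(N)` gauge transformation is the pullback of the pointwise inverse. [cite: Balaban1985Averaging, (8) p.19] -/
theorem pullGauge_inv (u : GaugeTransf P 0 (Matrix.specialUnitaryGroup (Fin N) ℂ)) (x₀ : Site P 0) :
    (pullGauge (fun x => Unitary.toUnits (toUGauge P N u x)) x₀)⁻¹ =
      pullGauge (fun x => Unitary.toUnits (toUGauge P N (fun x' => (u x')⁻¹) x)) x₀ := by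
  funext z
  simp only [Pi.inv_apply, pullGauge_apply, B8Thm2SetupTorus.toUGauge_apply, map_inv]

/-- `(U′U₀)♯ = U′♯·U₀♯` in the `ℤᵈ` lane's `mulCfg` ((1.16)). [cite: Balaban1985RegularSpaces, (1.16) p.78] -/
theorem mulCfg_pull (U' U₀ : GaugeField P 0 (Matrix.specialUnitaryGroup (Fin N) ℂ)) (x₀ : Site P 0) :
    mulCfg (pull (unitsField (toUField U')) x₀) (pull (unitsField (toUField U₀)) x₀) = pull (unitsField (toUField (fun b => U' b * U₀ b))) x₀ := by
  funext z μ
  simp only [mulCfg, pull_apply, unitsField, toUField, map_mul]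

/-- The `ℤᵈ` lane's perturbation of pullbacks is the pullback of (15): `pert♭ W♯ U₀♯ = (WU₀⁻¹)♯`. [cite: Balaban1985Variational, (15) p.280] -/
theorem pert_pull (W U₀ : GaugeField P 0 (Matrix.specialUnitaryGroup (Fin N) ℂ)) (x₀ : Site P 0) :
    B8Lemma1NonAbelian.pert (pull (unitsField (toUField W)) x₀) (pull (unitsField (toUField U₀)) x₀) =
      pull (unitsField (toUField (fun b => W b * (U₀ b)⁻¹))) x₀ := by
  funext z μ
  simp only [B8Lemma1NonAbelian.pert, pull_apply, unitsField, toUField, map_mul, map_inv]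

/-- Reading a pullback identity back on the torus, bondwise, as matrices. [cite: Balaban1985Averaging, (19) p.21] -/
theorem coe_pull_unitsField (W : GaugeField P 0 (Matrix.specialUnitaryGroup (Fin N) ℂ)) (x₀ : Site P 0) (b : PBond P 0) :
    ((pull (unitsField (toUField W)) x₀ (rel x₀ b.src) b.dir : (Matrix (Fin N) (Fin N) ℂ)ˣ) : Matrix (Fin N) (Fin N) ℂ) =
      ((W b : Matrix.specialUnitaryGroup (Fin N) ℂ) : Matrix (Fin N) (Fin N) ℂ) := by
  rw [pull_apply, transl_rel, val_unitsField]
  rfl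

end Pull

/-! ## §2 Row (T2) at one member from `Thm2SetupSUAt` at the `x₀`-translated pair -/

section Member

open Literature.MathematicalPhysics.QuantumFieldTheory.Balaban1983to89.T3ContinuumYM3Torus

variable (F : T3Family) {n K : ℕ}

/-- The trivial gauge transformation acts trivially (local helper). [folklore] -/
private theorem gaugeAct_one (U : GaugeField (F.P K) 0 (Matrix.specialUnitaryGroup (Fin 2) ℂ)) :
    GaugeField.gaugeAct (fun _ => (1 : Matrix.specialUnitaryGroup (Fin 2) ℂ)) U = U := by
  funext b; simp [GaugeField.gaugeAct]

/-- **ROW (T2) OF `prop2Printed_sPrint_of_thm2` AT ONE MEMBER FROM [6] THEOREM 2 AT THE SETUP-TORUS OBJECTS** (`B8Thm2SetupTorus.Thm2SetupSUAt (F.P K) 2 k η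
β₀ B₁ B₂ c₁ len (fun _ => True)`, `k = K − n`, `η = L^{−k}`, regularity rider dropped): apply the interface to the `x₀`-TRANSLATED pair `(τU₀, τ(UU₀⁻¹))`,
`x₀ = basePt F n K` — its hypotheses (1.33)₁ ∕ (1.34)₁ are `RegPr` (translation invariant, `inSpace_univ_translate_iff`), (1.34)₂ is `IsAxialPrint`
(`inAxT_translate_iff`), (1.35) is the based `Cond135T` (`hyp135T_translate_iff`, `hyp135_torusLam_iff`) — and translate the conclusion back:
`u(x) = uᵗ(x − (x₀ − 0))` has the based restriction (1.29) (`restr129T_translate_iff`), `U₁ := (UU₀⁻¹)^{u⁻¹}` relative to `U₀` ((1.17) = `mgauge`,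
`B8Eq131Derivation.eq117_eq_mgauge`) satisfies `(U₁U₀)^u = U` and `U₁ = e^{iηA}` bondwise for `A = τ⁻¹Aᵗ`, and (1.36) ∕ (1.38) ∕ (1.39) hold on the based pullbacks.
[cite: Balaban1985RegularSpaces, Thm 2 p.83, (1.17) p.78, (1.29) p.81, (1.33)-(1.38) p.82, (1.39) p.83; Balaban1985Variational, (15)-(18) p.280] -/
theorem thm2Based_of_thm2SetupSUAt {β₀ B₁ B₂ c₁ : ℝ} {len : LSite (F.P K).d → ℝ}
    (hT : Thm2SetupSUAt (F.P K) 2 (K - n) (eta F n K) β₀ B₁ B₂ c₁ len (fun _ => True))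
    {α₀ α₁ : ℝ} (hα₀ : 0 < α₀) (hα₁ : 0 < α₁) (hc : α₀ + α₁ ≤ c₁)
    (U₀ U : GaugeField (F.P K) 0 (Matrix.specialUnitaryGroup (Fin 2) ℂ)) (h₀ : RegPr F n K α₀ U₀) (hU : RegPr F n K α₀ U)
    (hax : IsAxialPrint F n K U₀ U)
    (h35 : Cond135T (F.P K).L (K - n) (pull (bgUnits F K U₀) (basePt F n K)) (pull (bgUnits F K (pert U₀ U)) (basePt F n K)) α₁) :
    ∃ (u : GaugeTransf (F.P K) 0 (Matrix.specialUnitaryGroup (Fin 2) ℂ))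
      (U₁ : GaugeField (F.P K) 0 (Matrix.specialUnitaryGroup (Fin 2) ℂ)) (A : PBond (F.P K) 0 → Matrix (Fin 2) (Fin 2) ℂ),
      RestrictedPrint F n K U₀ u ∧ GaugeField.gaugeAct u (emb15 U₀ U₁) = U ∧ (∀ b : PBond (F.P K) 0, IsSelfAdjoint (A b)) ∧
      (∀ b : PBond (F.P K) 0,
        ((U₁ b : Matrix.specialUnitaryGroup (Fin 2) ℂ) : Matrix (Fin 2) (Fin 2) ℂ) = exp (Complex.I • ((eta F n K) • A b))) ∧
      C136T (F.P K).L (K - n) (eta F n K) β₀ B₁ B₂ len (α₀ + α₁) (pull (bgUnits F K U₀) (basePt F n K)) (pull A (basePt F n K)) ∧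
      IsLandau138 (F.P K).L (K - n) (eta F n K) (Set.univ : Set (LSite (F.P K).d)) (torusLam (K - n))
        (pull (bgUnits F K U₀) (basePt F n K)) (pull A (basePt F n K)) ∧
      C139T (F.P K).L (K - n) (eta F n K) B₁ (α₀ + α₁) (pull (bgUnits F K U₀) (basePt F n K)) (pull A (basePt F n K)) := by
  -- the translation vector and the translated pair
  set x₀ : Site (F.P K) 0 := basePt F n K with hx₀
  set a : LSite (F.P K).d := rel 0 x₀ with ha
  set U₀t : GaugeField (F.P K) 0 (Matrix.specialUnitaryGroup (Fin 2) ℂ) := fun b => U₀ ⟨transl b.src a, b.dir⟩ with hU₀t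
  set Ut : GaugeField (F.P K) 0 (Matrix.specialUnitaryGroup (Fin 2) ℂ) := fun b => pert U₀ U ⟨transl b.src a, b.dir⟩ with hUt
  have hprod : (fun b => Ut b * U₀t b) = fun b : PBond (F.P K) 0 => U ⟨transl b.src a, b.dir⟩ := by
    funext b; exact inv_mul_cancel_right _ _
  -- (1.33)₁, (1.34)₁: translation-invariant `RegPr`
  have h33 : B10Eq68TorusRegularity.InSpace (K - n) (fun _ => (Set.univ : Set (Site (F.P K) 0))) α₀ (eta F n K) (toUField U₀t) :=
    (inSpace_univ_translate_iff (K - n) α₀ (eta F n K) (toUField U₀) x₀).2 ((regPr_iff_inSpace hα₀.le U₀).1 h₀)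
  have h34 : B10Eq68TorusRegularity.InSpace (K - n) (fun _ => (Set.univ : Set (Site (F.P K) 0))) α₀ (eta F n K)
      (toUField (fun b => Ut b * U₀t b)) := by
    rw [hprod]
    exact (inSpace_univ_translate_iff (K - n) α₀ (eta F n K) (toUField U) x₀).2 ((regPr_iff_inSpace hα₀.le U).1 hU)
  -- (1.34)₂: the based axial gauge
  have h34' : InAxT (F.P K) (K - n) (toUField U₀t) (toUField (fun b => Ut b * U₀t b)) := by
    rw [hprod]
    exact (inAxT_translate_iff (K - n) (toUField U₀) (toUField U) x₀).2 hax
  -- (1.35): the based `Cond135T`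
  have h35' : Hyp135T (F.P K) (K - n) α₁ (toUField U₀t) (toUField Ut) :=
    (hyp135T_translate_iff (K - n) α₁ (toUField U₀) (toUField (pert U₀ U)) x₀).2 ((hyp135_torusLam_iff _ _ _ _ _).2 h35)
  -- Theorem 2 at the translated pair
  obtain ⟨ut, ⟨h129, A', hsa', hmg, h36, -, h38, h39⟩, -⟩ := hT hα₀ hα₁ hc U₀t Ut h33 trivial h34 h34' h35'
  -- translate back
  set u : GaugeTransf (F.P K) 0 (Matrix.specialUnitaryGroup (Fin 2) ℂ) := fun x => ut (transl x (-a)) with hu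
  set A : PBond (F.P K) 0 → Matrix (Fin 2) (Fin 2) ℂ := fun b => A' ⟨transl b.src (-a), b.dir⟩ with hA
  have hut : (fun x => toUGauge (F.P K) 2 u (transl x a)) = toUGauge (F.P K) 2 ut := by
    funext x
    show B10Eq27TorusAxialLog.suIncl (ut (transl (transl x a) (-a))) = B10Eq27TorusAxialLog.suIncl (ut x)
    rw [← transl_add, add_neg_cancel, transl_zero]
  have hAt : (fun b : PBond (F.P K) 0 => A ⟨transl b.src a, b.dir⟩) = A' := translate_untranslate A' a
  -- the dictionary for the four pulled objects
  have hcU₀ : cfgPull (F.P K) (toUField U₀t) = pull (unitsField (toUField U₀)) x₀ := cfgPull_translate (toUField U₀) x₀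
  have hcUt : cfgPull (F.P K) (toUField Ut) = pull (unitsField (toUField (pert U₀ U))) x₀ := cfgPull_translate (toUField (pert U₀ U)) x₀
  have hgu : gaugePull (F.P K) (toUGauge (F.P K) 2 ut) = pullGauge (fun x => Unitary.toUnits (toUGauge (F.P K) 2 u x)) x₀ := by
    rw [← hut]; exact gaugePull_translate (toUGauge (F.P K) 2 u) x₀
  have hpA : pull A' 0 = pull A x₀ := by rw [← hAt]; exact pull_translate A x₀
  rw [hcU₀, hpA] at h36 h38 h39
  rw [hcU₀, hcUt, hgu, hpA] at hmg
  -- the restriction (1.29) of `u`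
  have hrestr : RestrictedPrint F n K U₀ u := by
    have h := h129
    rw [← hut] at h
    exact (restr129T_translate_iff (K - n) (toUField U₀) (toUGauge (F.P K) 2 u) x₀).1 h
  -- the perturbation `U₁ := (UU₀⁻¹)^{u⁻¹}` relative to `U₀`
  set U₁ : GaugeField (F.P K) 0 (Matrix.specialUnitaryGroup (Fin 2) ℂ) := pert U₀ (GaugeField.gaugeAct (fun x => (u x)⁻¹) U) with hU₁
  have hgauge : GaugeField.gaugeAct u (emb15 U₀ U₁) = U := by
    rw [hU₁, T3SectALandauChart.emb15_pert, gaugeAct_gaugeAct]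
    have : (fun x => u x * (fun x' => (u x')⁻¹) x) = fun _ => (1 : Matrix.specialUnitaryGroup (Fin 2) ℂ) := by
      funext x; simp
    rw [this, gaugeAct_one]
  -- `U₁♯ = mgauge U₀♯ (u♯)⁻¹ U′♯ = e^{iηA♯}`
  have hU₁pull : pull (unitsField (toUField U₁)) x₀ = cfgExp (eta F n K) (pull A x₀) := by
    rw [← hmg, pullGauge_inv, ← eq117_eq_mgauge, mulCfg_pull]
    have hUU : (fun b : PBond (F.P K) 0 => pert U₀ U b * U₀ b) = U := funext fun b => inv_mul_cancel_right _ _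
    rw [hUU, ← pull_toUField_gaugeAct, pert_pull]
    rw [hU₁]
    rfl
  refine ⟨u, U₁, A, hrestr, hgauge, fun b => hsa' _, fun b => ?_, h36, h38, h39⟩
  have h := congrArg (fun V : LSite (F.P K).d → Fin (F.P K).d → (Matrix (Fin 2) (Fin 2) ℂ)ˣ =>
    ((V (rel x₀ b.src) b.dir : (Matrix (Fin 2) (Fin 2) ℂ)ˣ) : Matrix (Fin 2) (Fin 2) ℂ)) hU₁pull
  simp only [coe_pull_unitsField] at h
  rw [h, cfgExp, val_expUnit, pull_apply, transl_rel]

end Member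

/-! ## §3 P-V3-A′ at `S_print` from the tree's [6]-Theorem-2 interface, by name -/

section Main

variable {L : ℕ}

/-- **P-V3-A′ AT `S_print` FROM `B8Thm2SetupTorus.Thm2SetupSUAt` BY NAME** (OWNER RULING g23-№3 (c2)): if for every member (`F.L = L`, `n < K`) [6] Theorem 2
holds at the Setup-torus objects for `SU(2)`, `k = K − n` levels, `η = L^{−k}`, constants `B₁, c₁` (any Hölder data `β₀, B₂, len`) and NO regularity
rider (`Reg := fun _ => True`, print p. 82 / [6] Prop. 6), then the v8 pillar text holds: `∃ B₁′ c₁′ > 0, B11.Prop2Printed B₁′ B₃ L³ c₁′ (famLG3 L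
(sPrint L T))`, every Sect. C–E tail `T`, every `B₃ ≥ 0`.  (= `Prop7SPrintCond135.prop2Printed_sPrint_of_thm2` ∘ `thm2Based_of_thm2SetupSUAt`.)
[cite: Balaban1985Variational, Prop. 2 p.281; Balaban1985RegularSpaces, Thm 2 p.83] -/
theorem prop2Printed_sPrint_of_thm2SetupSUAt (T : ResidFam L) {B₃ B₁ c₁ : ℝ} (hB₃ : 0 ≤ B₃) (hB₁ : 0 < B₁) (hc₁ : 0 < c₁)
    (hThm2 : ∀ (F : T3Family), F.L = L → ∀ (n K : ℕ), n < K →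
      ∃ (β₀ B₂ : ℝ) (len : LSite (F.P K).d → ℝ), Thm2SetupSUAt (F.P K) 2 (K - n) (eta F n K) β₀ B₁ B₂ c₁ len (fun _ => True)) :
    ∃ B₁' c₁' : ℝ, 0 < B₁' ∧ 0 < c₁' ∧ Prop2Printed B₁' B₃ ((L : ℝ) ^ 3) c₁' (famLG3 L (sPrint L T)) :=
  prop2Printed_sPrint_of_thm2 T hB₃ hB₁ hc₁ fun F hF n K hnK α₀ α₁ hα₀ hα₁ hc U₀ U h₀ hU hax h35 => by
    obtain ⟨β₀, B₂, len, hT⟩ := hThm2 F hF n K hnK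
    obtain ⟨u, U₁, A, h1, h2, h3, h4, h36, h38, h39⟩ := thm2Based_of_thm2SetupSUAt F hT hα₀ hα₁ hc U₀ U h₀ hU hax h35
    exact ⟨u, U₁, A, h1, h2, h3, h4, ⟨β₀, B₂, len, h36⟩, h38, h39⟩

end Main

end Summit.QuantumFields.YangMills.Theorems.Prop7SPrintThm2Dict

end
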